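import Summits.QuantumFields.BalabanUV.Beta.D1BFx.GluonNdlLocalWord

/-!
# `BalabanUV.Beta.D1BFx.GluonNdlLocalRow` — road «BF-x» for binder row D1, slot (K), END row `hGrp gN`, «GN-Q-T₂» part 2: THE `ndlPiece ⊗ SbT` PIECE OF THE GLUON
# NEEDLE ROW T₂ IS n-UNIFORM — `|cellSum n a (ndlPiece n a (cQ n)) SbT μ ν| ≤ C` for every `n ≥ 1`, ONE `C = C(a, cQ₀) ≥ 0`, modulo [B5, Prop. 1.2] ∧ [B5, (1.126)–(1.127)] BY NAME
# and `|cQ n| ≤ cQ₀` (P13) — the hypothesis `hnd` of `GluonNeedleGlueT12.h₂_of_pieces`; the needle sits at the PARTNER bond, so the census is paid at the `w`-sum by the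
# block-by-block exchange `Σ_u Σ_{s∈B(blk u)} = Σ_β Σ_{s∈B β} Σ_{u∈B β}` and M7

HONEST DEPENDENCY (cell records, verbatim): «continuum YM on T⁴ ⇐ BetaPertH ∧ nine spine estimates (0/9 proved); BetaPertH ⇐ (D1) ∧ (D4) ∧
CAP+tail; G-an2-4 gates asym, D1 and NE2/3/4.»  HONEST FRAMING (cell contract, verbatim): «discharging `BetaPertH` makes Bałaban's UV stability
UNCONDITIONAL — a real constructive-QFT result; it is NOT the continuum limit and NOT the Clay problem.»  THIS MODULE DISCHARGES NOTHING of the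
wall: [folklore] counting BY NAME over part 1 `GluonNdlLocalWord.abs_ndlLoc_word_le` (owner's transposed frame `LocalVertexForm.exists_SbT_outer_bound_left` + window shift),
the letters `NeedleNdlProjLetters.exists_applyK_grad_row_le`, `GluonLocalNdlLetters.exists_applyK_grad_row_diff_le` ∕ `exists_applyK_gradC_diff_le` (this seat) and
`NeedleColumnLetters.exists_applyK_gradC_le` (owner), gan24-leaf-05-g41's bond marginal `NeedleBondMarginal.sum_bond_abs_qJet_le` (M7), the block bookkeeping
`B6QGQLower276.U` ∕ `sum_U` ∕ `subset_U_image` ∕ `dist_le_of_blk_eq`, leaf-04-g9's damped moments `LatticeHLSProfiles.sum_pow_mul_exp_div_nrm_pow_free_scale_le` and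
`LatticeHLSPairing.abs_fullSum_le_of_abs_sum_le`, the owner's `NeedleProjProjRow.sum_resSite_avg_le`.  No `def`, no `def … : Prop`, nothing cited, 0 sorry; the printed
statements are HYPOTHESES by name.  Root-level binders hW ∕ hR-sockets ∕ hSX-socket ∕ D1Tel ∕ D1Rep — 0 discharged; (K) NOT closed (T₂ pieces: Q̇ (this file); P, K open);
NOT D1, NOT `BetaPertH`, NOT continuum, NOT Clay.

ABSOLUTE RULE (cell charter, verbatim): «No internally-minted statement may enter as a cited fact. Every hypothesis is either kernel-proved in
this package or a verbatim quotation of a PUBLISHED theorem with page reference. The manuscript(s) under audit are NOT citable for their own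
disputed steps — they are the thing under adjudication; programme-internal (2001/route/tribunal) claims are never citable.»

WHY (owner d1-p2-g10 SEAT-CLOSING l.31284 «UNCLAIMED … T₂-P∕K∕Q̇ — all on landed frames»).  THE COUNT.  Part 1 gives, at `(b, w)` with `u = b + w`,
`|word| ≤ K·Σ_{s∈B(blk u)}|qJet_u s|·(A·E₂(b−s) + B·E₁(b−s))`, `A = KΦ′c₂(KN+KN′) ≍ n⁻¹`, `B = KΦc₁KN′ ≍ n⁻²`.  Summing `|w_μw_ν|·(…)` over `w` block by block: for `u, s` in the
same block `|w_μw_ν| = |(u−b)_μ(u−b)_ν| ≤ 2‖b−s‖² + 2n²` and `Σ_{u∈B β}|qJet_u s| ≤ (n−1)·n⁻⁴` (M7), so the `w`-sum is `≤ ((n−1)n⁻⁴)·Σ_s (2‖b−s‖² + 2n²)(A·E₂ + B·E₁)(b−s)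
≍ n⁻³·(n⁻¹·n⁴ + n⁻²·n⁵) = n⁰` PER BASE SITE (uniform), and the base average is convex.  n⁰ with NO cancellation.

CONTENT (`a > 0`, `n ≥ 1`).
* §1 [folklore] `abs_weight_le_of_same_block` (`|(u−b)_μ(u−b)_ν| ≤ 2‖b−s‖² + 2n²` for `u, s` in one block), `sum_moment_prof_le` (`Σ_{s∈S}(2‖b−s‖²+2n²)E_p(b−s) ≤ 2C₂ₚn^{6−p} + 2n²C₀ₚn^{4−p}`),
  **`abs_fullSum_ndlLoc_le`** — the (1.22) sum at one base site from the frame and abstract letters: `≤ ((n−1)n⁻⁴)·K·((KΦ′c₂M₂)(KN+KN′) + (KΦc₁M₁)KN′)`.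
* §2 [folklore] **`exists_ndlLoc_row_le`** — `∃ C ≥ 0, ∀ n [NeZero n], |cellSum n a (ndlPiece n a (cQ n)) SbT μ ν| ≤ C` modulo `h12`∕`h126` and `hcQ` (= `hnd` of `h₂_of_pieces`).
NOT HERE (honest): T₂-P, T₂-K; the `h₂` glue (owner).
Unit `b2b-balaban-beta-d1-formalise-leaf-01` (gen 15), D1 formalisation swarm LEAF PROVER 01 on cross-road kernel duty; `LEAVES-BFx.md` row (N) «GN-Q-T₂» part 2.
-/

noncomputable section

namespace Summit.QuantumFields.BalabanUV.Beta.D1BFx.GluonNdlLocalRow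

open Finset
open scoped BigOperators
open Literature.MathematicalPhysics.QuantumFieldTheory.Balaban1983to89
open Literature.MathematicalPhysics.QuantumFieldTheory.Balaban1983to89.Beta
open B4Sect5Proof (latticeConst latticeConst_nonneg)
open B6QGQLower276 (X e blk B mem_B U sum_U subset_U_image dist_le_of_blk_eq)
open B6QGQDecay237 (card_B)
open ExpKernelCalculus (Site MKer Decays)
open DyadicShell (Pt toReal toReal_apply)
open WindowIdentification (fullSum)
open DressedMomentNormalisation (resSite)
open AffineAveraging (unitVec)
open VectorTailsLoc (fam kfam)
open Beta.PoissonInterior (nrm nrm_pos one_le_nrm nrm_neg supNorm_le_nrm)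
open Summit.QuantumFields.BalabanUV.Beta.TameKernelCalculus (Spr)
open Summit.QuantumFields.BalabanUV.Beta.D1BFx.PackedKernelSplit (biBubble)
open Summit.QuantumFields.BalabanUV.Beta.D1BFx.FineHessianSectors (biBubbleTable)
open Summit.QuantumFields.BalabanUV.Beta.D1BFx.RProjector (Pgt kerP)
open Summit.QuantumFields.BalabanUV.Beta.D1BFx.ProjectorSupNorm (cPPs cPs cPPs_nonneg cPs_nonneg)
open Summit.QuantumFields.BalabanUV.Beta.D1BFx.GluonLeg (Ga)
open Summit.QuantumFields.BalabanUV.Beta.D1BFx.GluonLegTails (spr_Ga_of_prop12)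
open Summit.QuantumFields.BalabanUV.Beta.D1BFx.FrozenLegTails (nOf MOf hn1)
open Summit.QuantumFields.BalabanUV.Beta.D1BFx.GhostLeg (cast_pred_add_one)
open Summit.QuantumFields.BalabanUV.Beta.D1BFx.GhostStencil (qJet)
open Summit.QuantumFields.BalabanUV.Beta.D1BFx.SectorRecut (SbT)
open Summit.QuantumFields.BalabanUV.Beta.D1BFx.GluonNeedleSplit (ndlPiece)
open Summit.QuantumFields.BalabanUV.Beta.D1BFx.GluonNeedleGlue (cellSum cellSum_def)
open Summit.QuantumFields.BalabanUV.Beta.D1BFx.RankOneBubble (outer applyK applyKT pairing)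
open Summit.QuantumFields.BalabanUV.Beta.D1BFx.RankOneBubbleJets (grad)
open Summit.QuantumFields.BalabanUV.Beta.D1BFx.NeedlePotentialLetters (ndlRow)
open Summit.QuantumFields.BalabanUV.Beta.D1BFx.NeedleColumnLetters (exists_applyK_gradC_le)
open Summit.QuantumFields.BalabanUV.Beta.D1BFx.NeedleNdlProjLetters (exists_applyK_grad_row_le)
open Summit.QuantumFields.BalabanUV.Beta.D1BFx.GluonLocalNdlLetters (exists_applyK_grad_row_diff_le exists_applyK_gradC_diff_le)
open Summit.QuantumFields.BalabanUV.Beta.D1BFx.GluonNdlLocalWord (abs_ndlLoc_word_le)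
open Summit.QuantumFields.BalabanUV.Beta.D1BFx.NeedleProjProjRow (abs_weight_le_sq sum_resSite_avg_le)
open Summit.QuantumFields.BalabanUV.Beta.D1BFx.GhostLegBlockMass (dist_eq_supNorm)
open Summit.QuantumFields.BalabanUV.Beta.D1BFx.LatticeHLSProfiles (supNorm_dyadic)
open Summit.QuantumFields.BalabanUV.Beta.D1BFx.LatticeHLSPairing (abs_fullSum_le_of_abs_sum_le)
open Summit.QuantumFields.BalabanUV.Beta.D1BFx.LocalVertexForm (exists_SbT_outer_bound_left)

variable (n : ℕ) [NeZero n] (a : ℝ)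

/-! ## §1 The (1.22) sum at one base site: block-by-block exchange and the bond marginal -/

variable {n} in
omit [NeZero n] in
/-- [folklore] the weight against a site of the SAME block: for `u, s ∈ B β`, `|(u−b)_μ·(u−b)_ν| ≤ 2‖b−s‖∞² + 2n²` (`‖u−b‖ ≤ ‖u−s‖ + ‖s−b‖`, `‖u−s‖ ≤ n−1` in one block). -/
theorem abs_weight_le_of_same_block (β u s b : Pt) (hu : u ∈ B (n - 1) β) (hs : s ∈ B (n - 1) β) (μ ν : Fin 4) :
    |toReal (u - b) μ * toReal (u - b) ν| ≤ 2 * (PoissonInterior.supNorm (d := 4) (b - s) : ℝ) ^ 2 + 2 * (n : ℝ) ^ 2 := by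
  have h1 := abs_weight_le_sq (u - b) μ ν
  rw [supNorm_dyadic] at h1
  have h2 : (PoissonInterior.supNorm (d := 4) (u - b) : ℝ) ≤ PoissonInterior.supNorm (d := 4) (u - s) + PoissonInterior.supNorm (d := 4) (s - b) := by
    have h := PoissonInterior.supNorm_add_le (d := 4) (u - s) (s - b)
    rw [show u - s + (s - b) = u - b by abel] at h
    exact_mod_cast h
  have h3 : (PoissonInterior.supNorm (d := 4) (u - s) : ℝ) ≤ n := by
    have h := dist_le_of_blk_eq (n := n - 1) (p := u) (q := s) (by rw [mem_B.1 hu, mem_B.1 hs])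
    rw [dist_eq_supNorm, supNorm_dyadic] at h
    exact h.trans (by exact_mod_cast Nat.sub_le n 1)
  have h4 : (PoissonInterior.supNorm (d := 4) (s - b) : ℝ) = PoissonInterior.supNorm (d := 4) (b - s) := by
    rw [show s - b = -(b - s) by abel, PoissonInterior.supNorm_neg]
  rw [h4] at h2
  have h0 : (0 : ℝ) ≤ PoissonInterior.supNorm (d := 4) (b - s) := by positivity
  have hn : (0 : ℝ) ≤ n := by positivity
  nlinarith [h1, h2, h3, h0, hn, sq_nonneg ((PoissonInterior.supNorm (d := 4) (b - s) : ℝ) - n)]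

variable {n} in
/-- [folklore] the weighted damped moment centred at the base, any `p ≤ 3`, over any finite set:
`Σ_{s∈S} (2‖b−s‖² + 2n²)·e^{−(ε∕n)‖b−s‖}∕nrm(b−s)^p ≤ 2·(C₂·n^{4−p+2}) + 2n²·(C₀·n^{4−p+0})`. -/
theorem sum_moment_prof_le {ε : ℝ} (hε : 0 < ε) {p : ℕ} (hp : p ≤ 3) (b : Pt) (S : Finset Pt) :
    ∑ s ∈ S, (2 * (PoissonInterior.supNorm (d := 4) (b - s) : ℝ) ^ 2 + 2 * (n : ℝ) ^ 2) *
        (Real.exp (-(ε / n) * PoissonInterior.supNorm (d := 4) (b - s)) / nrm (b - s) ^ p)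
      ≤ 2 * (2 * (Nat.factorial 2) * (2 / ε) ^ 2 * (1 + 2 * (4 : ℕ) * 3 ^ (4 - 1) * ((Nat.factorial (4 - 1 - p)) * (4 / ε) ^ (4 - 1 - p) * (1 + 4 / ε)))
            * (n : ℝ) ^ (4 - p + 2))
        + 2 * (n : ℝ) ^ 2 * (2 * (Nat.factorial 0) * (2 / ε) ^ 0 * (1 + 2 * (4 : ℕ) * 3 ^ (4 - 1) * ((Nat.factorial (4 - 1 - p)) * (4 / ε) ^ (4 - 1 - p) * (1 + 4 / ε)))
            * (n : ℝ) ^ (4 - p + 0)) := by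
  have hn1 : 1 ≤ n := NeZero.one_le
  have hp' : p ≤ 4 - 1 := by omega
  have hq := LatticeHLSProfiles.sum_pow_mul_exp_div_nrm_pow_free_scale_le (d := 4) (by norm_num) hε hn1 hp' 2 S b b
  have h0 := LatticeHLSProfiles.sum_pow_mul_exp_div_nrm_pow_free_scale_le (d := 4) (by norm_num) hε hn1 hp' 0 S b b
  have e : ∀ s : Pt, PoissonInterior.supNorm (d := 4) (b - s) = PoissonInterior.supNorm (d := 4) (s - b) ∧ nrm (b - s) = nrm (s - b) := fun s => by
    rw [show b - s = -(s - b) by abel, PoissonInterior.supNorm_neg, nrm_neg]; exact ⟨rfl, rfl⟩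
  have hq' : ∑ s ∈ S, (PoissonInterior.supNorm (d := 4) (b - s) : ℝ) ^ 2 *
      (Real.exp (-(ε / n) * PoissonInterior.supNorm (d := 4) (b - s)) / nrm (b - s) ^ p) ≤ _ :=
    le_trans (le_of_eq (Finset.sum_congr rfl fun s _ => by rw [(e s).1, (e s).2, mul_div_assoc])) hq
  have h0' : ∑ s ∈ S, (Real.exp (-(ε / n) * PoissonInterior.supNorm (d := 4) (b - s)) / nrm (b - s) ^ p) ≤ _ :=
    le_trans (le_of_eq (Finset.sum_congr rfl fun s _ => by rw [(e s).1, (e s).2, pow_zero, one_mul])) h0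
  calc ∑ s ∈ S, (2 * (PoissonInterior.supNorm (d := 4) (b - s) : ℝ) ^ 2 + 2 * (n : ℝ) ^ 2) *
        (Real.exp (-(ε / n) * PoissonInterior.supNorm (d := 4) (b - s)) / nrm (b - s) ^ p)
      = 2 * ∑ s ∈ S, (PoissonInterior.supNorm (d := 4) (b - s) : ℝ) ^ 2 *
          (Real.exp (-(ε / n) * PoissonInterior.supNorm (d := 4) (b - s)) / nrm (b - s) ^ p)
        + 2 * (n : ℝ) ^ 2 * ∑ s ∈ S, (Real.exp (-(ε / n) * PoissonInterior.supNorm (d := 4) (b - s)) / nrm (b - s) ^ p) := by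
        rw [Finset.mul_sum, Finset.mul_sum, ← Finset.sum_add_distrib]
        exact Finset.sum_congr rfl fun s _ => by ring
    _ ≤ _ := add_le_add (mul_le_mul_of_nonneg_left hq' (by norm_num)) (mul_le_mul_of_nonneg_left h0' (by positivity))

/-- [folklore] **THE (1.22) SUM OF THE `ndl ⊗ SbT` WORD AT ONE BASE SITE, FROM THE TRANSPOSED FRAME AND ABSTRACT LETTERS** — uniform in the base site:
`|fullSum (w ↦ w_μw_ν·word(b,w))| ≤ ((n−1)n⁻⁴)·K·((KΦ′c₂·M₂)·(KN+KN′) + (KΦc₁·M₁)·KN′)` (the partner needle's census by the block-by-block exchange and M7). -/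
theorem abs_fullSum_ndlLoc_le (ha : 0 < a) (hA : Spr (Ga n a)) {K : ℝ} {R : ℕ} (hK : 0 ≤ K)
    (hframe : ∀ (κ : Fin 4) (u : Pt) (A B : MKer 4 (Fin 4)) (φ ψ : Pt → Fin 4 → ℝ),
      (∀ (r : Pt) (g : Fin 4), Summable fun y : Pt => ∑ a', ψ y a' * B y r a' g) →
      ∀ (Φ₀ Φ₁ Γ₀ Γ₁ : ℝ), 0 ≤ Φ₀ → 0 ≤ Φ₁ → 0 ≤ Γ₀ → 0 ≤ Γ₁ →
      (∀ (q : Pt) (g : Fin 4), DyadicShell.supNorm (q - u) ≤ R → |applyKT ψ B q g| ≤ Φ₀) →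
      (∀ (q : Pt) (g : Fin 4) (i : Fin 4), DyadicShell.supNorm (q - u) ≤ R → |applyKT ψ B (q + unitVec i) g - applyKT ψ B q g| ≤ Φ₁) →
      (∀ (q : Pt) (f : Fin 4), DyadicShell.supNorm (q - u) ≤ R → |applyK A φ q f| ≤ Γ₀) →
      (∀ (q : Pt) (f : Fin 4) (i : Fin 4), DyadicShell.supNorm (q - u) ≤ R → |applyK A φ (q + unitVec i) f - applyK A φ q f| ≤ Γ₁) →
      |biBubble A (outer φ ψ) B (SbT κ u)| ≤ K * (Φ₁ * Γ₀ + Φ₀ * Γ₁ + Φ₁ * Γ₁))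
    {cQ KΦ KΦ' KN KN' ε : ℝ} (hKΦ : 0 ≤ KΦ) (hKΦ' : 0 ≤ KΦ') (hKN : 0 ≤ KN) (hKN' : 0 ≤ KN') (hε : 0 < ε)
    (hΦ : ∀ (κ : Fin 4) (u x : Pt) (α : Fin 4), |applyK (Ga n a) (grad (ndlRow n a κ u)) x α|
      ≤ KΦ * ∑ s ∈ B (n - 1) (blk (n - 1) u), |qJet n κ u (blk (n - 1) u) s|
          * (Real.exp (-(ε / n) * PoissonInterior.supNorm (d := 4) (x - s)) / nrm (x - s) ^ 1))
    (hΦ' : ∀ (κ : Fin 4) (u x : Pt) (α i : Fin 4), |applyK (Ga n a) (grad (ndlRow n a κ u)) (x + unitVec i) α - applyK (Ga n a) (grad (ndlRow n a κ u)) x α|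
      ≤ KΦ' * ∑ s ∈ B (n - 1) (blk (n - 1) u), |qJet n κ u (blk (n - 1) u) s|
          * (Real.exp (-(ε / n) * PoissonInterior.supNorm (d := 4) (x - s)) / nrm (x - s) ^ 2))
    (hN : ∀ (u x : Pt) (α : Fin 4), |applyK (Ga n a)
        (grad (fun q => cQ * (∑ z ∈ B (n - 1) (blk (n - 1) u), Pgt n a z q () ()) - kerP (d := 4) (n - 1) a q (blk (n - 1) u))) x α| ≤ KN)
    (hN' : ∀ (u x : Pt) (α i : Fin 4), |applyK (Ga n a)
        (grad (fun q => cQ * (∑ z ∈ B (n - 1) (blk (n - 1) u), Pgt n a z q () ()) - kerP (d := 4) (n - 1) a q (blk (n - 1) u))) (x + unitVec i) α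
        - applyK (Ga n a) (grad (fun q => cQ * (∑ z ∈ B (n - 1) (blk (n - 1) u), Pgt n a z q () ()) - kerP (d := 4) (n - 1) a q (blk (n - 1) u))) x α|
        ≤ KN')
    (μ ν : Fin 4) (b : Pt) :
    |fullSum (fun w : Pt => toReal w μ * toReal w ν * biBubbleTable (Ga n a) (Ga n a) (ndlPiece n a cQ) SbT μ ν (b + w) b)|
      ≤ (((n : ℝ) - 1) * ((n : ℝ) ^ 4)⁻¹) * (K *
        ((KΦ' * (Real.exp (ε * R) * ((R : ℝ) + 1) ^ 2) *
          (2 * (2 * (Nat.factorial 2) * (2 / ε) ^ 2 * (1 + 2 * (4 : ℕ) * 3 ^ (4 - 1) * ((Nat.factorial (4 - 1 - 2)) * (4 / ε) ^ (4 - 1 - 2) * (1 + 4 / ε)))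
              * (n : ℝ) ^ (4 - 2 + 2))
            + 2 * (n : ℝ) ^ 2 * (2 * (Nat.factorial 0) * (2 / ε) ^ 0 * (1 + 2 * (4 : ℕ) * 3 ^ (4 - 1) * ((Nat.factorial (4 - 1 - 2)) * (4 / ε) ^ (4 - 1 - 2) * (1 + 4 / ε)))
              * (n : ℝ) ^ (4 - 2 + 0)))) * (KN + KN')
        + (KΦ * (Real.exp (ε * R) * ((R : ℝ) + 1) ^ 1) *
          (2 * (2 * (Nat.factorial 2) * (2 / ε) ^ 2 * (1 + 2 * (4 : ℕ) * 3 ^ (4 - 1) * ((Nat.factorial (4 - 1 - 1)) * (4 / ε) ^ (4 - 1 - 1) * (1 + 4 / ε)))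
              * (n : ℝ) ^ (4 - 1 + 2))
            + 2 * (n : ℝ) ^ 2 * (2 * (Nat.factorial 0) * (2 / ε) ^ 0 * (1 + 2 * (4 : ℕ) * 3 ^ (4 - 1) * ((Nat.factorial (4 - 1 - 1)) * (4 / ε) ^ (4 - 1 - 1) * (1 + 4 / ε)))
              * (n : ℝ) ^ (4 - 1 + 0)))) * KN')) := by
  classical
  have hn : (0 : ℝ) < n := by exact_mod_cast Nat.pos_of_ne_zero (NeZero.ne n)
  have hn1 : (1 : ℝ) ≤ n := by exact_mod_cast NeZero.one_le
  set m : ℕ := n - 1 with hm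
  set c₁ : ℝ := Real.exp (ε * R) * ((R : ℝ) + 1) ^ 1 with hc₁
  set c₂ : ℝ := Real.exp (ε * R) * ((R : ℝ) + 1) ^ 2 with hc₂
  set M₂ : ℝ := 2 * (2 * (Nat.factorial 2) * (2 / ε) ^ 2 * (1 + 2 * (4 : ℕ) * 3 ^ (4 - 1) * ((Nat.factorial (4 - 1 - 2)) * (4 / ε) ^ (4 - 1 - 2) * (1 + 4 / ε)))
        * (n : ℝ) ^ (4 - 2 + 2))
      + 2 * (n : ℝ) ^ 2 * (2 * (Nat.factorial 0) * (2 / ε) ^ 0 * (1 + 2 * (4 : ℕ) * 3 ^ (4 - 1) * ((Nat.factorial (4 - 1 - 2)) * (4 / ε) ^ (4 - 1 - 2) * (1 + 4 / ε)))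
        * (n : ℝ) ^ (4 - 2 + 0)) with hM₂
  set M₁ : ℝ := 2 * (2 * (Nat.factorial 2) * (2 / ε) ^ 2 * (1 + 2 * (4 : ℕ) * 3 ^ (4 - 1) * ((Nat.factorial (4 - 1 - 1)) * (4 / ε) ^ (4 - 1 - 1) * (1 + 4 / ε)))
        * (n : ℝ) ^ (4 - 1 + 2))
      + 2 * (n : ℝ) ^ 2 * (2 * (Nat.factorial 0) * (2 / ε) ^ 0 * (1 + 2 * (4 : ℕ) * 3 ^ (4 - 1) * ((Nat.factorial (4 - 1 - 1)) * (4 / ε) ^ (4 - 1 - 1) * (1 + 4 / ε)))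
        * (n : ℝ) ^ (4 - 1 + 0)) with hM₁
  set Acoef : ℝ := K * (KΦ' * c₂ * (KN + KN')) with hAcoef
  set Bcoef : ℝ := K * (KΦ * c₁ * KN') with hBcoef
  have hA0 : 0 ≤ Acoef := by positivity
  have hB0 : 0 ≤ Bcoef := by positivity
  -- the site function `g` and the block function `h`
  set g : Pt → ℝ := fun s => Acoef * (Real.exp (-(ε / n) * PoissonInterior.supNorm (d := 4) (b - s)) / nrm (b - s) ^ 2)
    + Bcoef * (Real.exp (-(ε / n) * PoissonInterior.supNorm (d := 4) (b - s)) / nrm (b - s) ^ 1) with hg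
  have hg0 : ∀ s, 0 ≤ g s := fun s => add_nonneg (mul_nonneg hA0 (div_nonneg (Real.exp_pos _).le (pow_nonneg (nrm_pos _).le 2)))
    (mul_nonneg hB0 (div_nonneg (Real.exp_pos _).le (pow_nonneg (nrm_pos _).le 1)))
  set h : Pt → ℝ := fun u => |toReal (u - b) μ * toReal (u - b) ν| * ∑ s ∈ B m (blk m u), |qJet n μ u (blk m u) s| * g s with hh
  have hh0 : ∀ u, 0 ≤ h u := fun u => mul_nonneg (abs_nonneg _) (Finset.sum_nonneg fun s _ => mul_nonneg (abs_nonneg _) (hg0 s))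
  -- the pointwise domination: `|w_μw_ν·word(b,w)| ≤ h (b + w)`
  have hgsum : ∀ u : Pt, ∑ s ∈ B m (blk m u), |qJet n μ u (blk m u) s| * g s
      = Acoef * ∑ s ∈ B m (blk m u), |qJet n μ u (blk m u) s| * (Real.exp (-(ε / n) * PoissonInterior.supNorm (d := 4) (b - s)) / nrm (b - s) ^ 2)
        + Bcoef * ∑ s ∈ B m (blk m u), |qJet n μ u (blk m u) s| * (Real.exp (-(ε / n) * PoissonInterior.supNorm (d := 4) (b - s)) / nrm (b - s) ^ 1) := by
    intro u
    rw [Finset.mul_sum, Finset.mul_sum, ← Finset.sum_add_distrib]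
    exact Finset.sum_congr rfl fun s _ => by simp only [hg]; ring
  have hdom : ∀ w : Pt, |toReal w μ * toReal w ν * biBubbleTable (Ga n a) (Ga n a) (ndlPiece n a cQ) SbT μ ν (b + w) b| ≤ h (b + w) := by
    intro w
    have hw := abs_ndlLoc_word_le n a ha hA hframe hKΦ hKΦ' hKN hKN' hε hΦ hΦ' hN hN' μ ν b w
    rw [abs_mul, hh]
    simp only [add_sub_cancel_left]
    rw [hgsum]
    refine mul_le_mul_of_nonneg_left (hw.trans (le_of_eq ?_)) (abs_nonneg _)
    rw [hAcoef, hBcoef]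
    ring
  -- one block: the bond marginal M7 and the weight bound
  have hblock : ∀ β : Pt, ∑ u ∈ B m β, h u ≤ (((n : ℝ) - 1) * ((n : ℝ) ^ 4)⁻¹) *
      ∑ s ∈ B m β, (2 * (PoissonInterior.supNorm (d := 4) (b - s) : ℝ) ^ 2 + 2 * (n : ℝ) ^ 2) * g s := by
    intro β
    calc ∑ u ∈ B m β, h u = ∑ u ∈ B m β, ∑ s ∈ B m β, |toReal (u - b) μ * toReal (u - b) ν| * (|qJet n μ u β s| * g s) := by
          refine Finset.sum_congr rfl fun u hu => ?_
          rw [hh]; simp only [mem_B.1 hu, Finset.mul_sum]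
      _ = ∑ s ∈ B m β, ∑ u ∈ B m β, |toReal (u - b) μ * toReal (u - b) ν| * (|qJet n μ u β s| * g s) := Finset.sum_comm
      _ ≤ ∑ s ∈ B m β, ∑ u ∈ B m β, (2 * (PoissonInterior.supNorm (d := 4) (b - s) : ℝ) ^ 2 + 2 * (n : ℝ) ^ 2) * (|qJet n μ u β s| * g s) :=
          Finset.sum_le_sum fun s hs => Finset.sum_le_sum fun u hu =>
            mul_le_mul_of_nonneg_right (abs_weight_le_of_same_block β u s b hu hs μ ν) (mul_nonneg (abs_nonneg _) (hg0 s))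
      _ = ∑ s ∈ B m β, (2 * (PoissonInterior.supNorm (d := 4) (b - s) : ℝ) ^ 2 + 2 * (n : ℝ) ^ 2) * g s * ∑ u ∈ B m β, |qJet n μ u β s| := by
          refine Finset.sum_congr rfl fun s _ => ?_
          rw [Finset.mul_sum]; exact Finset.sum_congr rfl fun u _ => by ring
      _ ≤ ∑ s ∈ B m β, (2 * (PoissonInterior.supNorm (d := 4) (b - s) : ℝ) ^ 2 + 2 * (n : ℝ) ^ 2) * g s * (((n : ℝ) - 1) * ((n : ℝ) ^ 4)⁻¹) :=
          Finset.sum_le_sum fun s _ => mul_le_mul_of_nonneg_left (NeedleBondMarginal.sum_bond_abs_qJet_le n μ _ β s)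
            (mul_nonneg (by positivity) (hg0 s))
      _ = _ := by rw [Finset.mul_sum]; exact Finset.sum_congr rfl fun s _ => by ring
  -- the moment sums over any finite set of sites
  have hmom : ∀ T : Finset Pt, ∑ s ∈ T, (2 * (PoissonInterior.supNorm (d := 4) (b - s) : ℝ) ^ 2 + 2 * (n : ℝ) ^ 2) * g s ≤ Acoef * M₂ + Bcoef * M₁ := by
    intro T
    have h2 := sum_moment_prof_le (n := n) hε (p := 2) (by norm_num) b T
    have h1 := sum_moment_prof_le (n := n) hε (p := 1) (by norm_num) b T
    rw [← hM₂] at h2; rw [← hM₁] at h1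
    calc ∑ s ∈ T, (2 * (PoissonInterior.supNorm (d := 4) (b - s) : ℝ) ^ 2 + 2 * (n : ℝ) ^ 2) * g s
        = Acoef * ∑ s ∈ T, (2 * (PoissonInterior.supNorm (d := 4) (b - s) : ℝ) ^ 2 + 2 * (n : ℝ) ^ 2) *
              (Real.exp (-(ε / n) * PoissonInterior.supNorm (d := 4) (b - s)) / nrm (b - s) ^ 2)
          + Bcoef * ∑ s ∈ T, (2 * (PoissonInterior.supNorm (d := 4) (b - s) : ℝ) ^ 2 + 2 * (n : ℝ) ^ 2) *
              (Real.exp (-(ε / n) * PoissonInterior.supNorm (d := 4) (b - s)) / nrm (b - s) ^ 1) := by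
          rw [Finset.mul_sum, Finset.mul_sum, ← Finset.sum_add_distrib]
          exact Finset.sum_congr rfl fun s _ => by rw [hg]; ring
      _ ≤ Acoef * M₂ + Bcoef * M₁ := add_le_add (mul_le_mul_of_nonneg_left h2 hA0) (mul_le_mul_of_nonneg_left h1 hB0)
  -- the finite partial sums
  have hfin : ∀ S : Finset Pt, ∑ w ∈ S, |toReal w μ * toReal w ν * biBubbleTable (Ga n a) (Ga n a) (ndlPiece n a cQ) SbT μ ν (b + w) b|
      ≤ (((n : ℝ) - 1) * ((n : ℝ) ^ 4)⁻¹) * (Acoef * M₂ + Bcoef * M₁) := by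
    intro S
    set S' : Finset Pt := S.map (addLeftEmbedding b) with hS'
    have hmn : 0 ≤ ((n : ℝ) - 1) * ((n : ℝ) ^ 4)⁻¹ := mul_nonneg (sub_nonneg.2 hn1) (by positivity)
    calc ∑ w ∈ S, |toReal w μ * toReal w ν * biBubbleTable (Ga n a) (Ga n a) (ndlPiece n a cQ) SbT μ ν (b + w) b|
        ≤ ∑ w ∈ S, h (b + w) := Finset.sum_le_sum fun w _ => hdom w
      _ = ∑ u ∈ S', h u := by rw [hS', Finset.sum_map]; rfl
      _ ≤ ∑ u ∈ U m (S'.image (blk m)), h u := Finset.sum_le_sum_of_subset_of_nonneg (subset_U_image m S') fun u _ _ => hh0 u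
      _ = ∑ β ∈ S'.image (blk m), ∑ u ∈ B m β, h u := sum_U _ _
      _ ≤ ∑ β ∈ S'.image (blk m), (((n : ℝ) - 1) * ((n : ℝ) ^ 4)⁻¹) *
            ∑ s ∈ B m β, (2 * (PoissonInterior.supNorm (d := 4) (b - s) : ℝ) ^ 2 + 2 * (n : ℝ) ^ 2) * g s := Finset.sum_le_sum fun β _ => hblock β
      _ = (((n : ℝ) - 1) * ((n : ℝ) ^ 4)⁻¹) * ∑ s ∈ U m (S'.image (blk m)), (2 * (PoissonInterior.supNorm (d := 4) (b - s) : ℝ) ^ 2 + 2 * (n : ℝ) ^ 2) * g s := by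
          rw [← Finset.mul_sum, sum_U]
      _ ≤ (((n : ℝ) - 1) * ((n : ℝ) ^ 4)⁻¹) * (Acoef * M₂ + Bcoef * M₁) := mul_le_mul_of_nonneg_left (hmom _) hmn
  have hres := (abs_fullSum_le_of_abs_sum_le hfin).2
  refine hres.trans (le_of_eq ?_)
  rw [hAcoef, hBcoef, hc₁, hc₂, hM₂, hM₁]; ring

/-! ## §2 The piece: letters instantiated, the base average convex -/

variable {n}

/-- [folklore] **«GN-Q-T₂»: THE `ndlPiece ⊗ SbT` PIECE OF T₂ IS n-UNIFORM** — the hypothesis `hnd` of `GluonNeedleGlueT12.h₂_of_pieces`, modulo [B5, Prop. 1.2] ∧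
[B5, (1.126)–(1.127)] BY NAME and a uniform bound `cQ₀` on the stencil weight `cQ n` (P13: `C = C(a, cQ₀)`): one `C ≥ 0` with
`|cellSum n a (ndlPiece n a (cQ n)) SbT μ ν| ≤ C` for every `n ≥ 1`. -/
theorem exists_ndlLoc_row_le (ha : 0 < a) (h12 : B5.Prop12Printed (fam nOf hn1 MOf a ha)) (h126 : B5.Kernel126_127Printed (kfam nOf MOf))
    {cQ : ℕ → ℝ} {cQ₀ : ℝ} (hcQ : ∀ n, |cQ n| ≤ cQ₀) (μ ν : Fin 4) :
    ∃ C : ℝ, 0 ≤ C ∧ ∀ (n : ℕ) [NeZero n], |cellSum n a (ndlPiece n a (cQ n)) SbT μ ν| ≤ C := by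
  obtain ⟨K, R, hK, hframe⟩ := exists_SbT_outer_bound_left
  obtain ⟨kΦ, ε₀, hε₀, hkΦ, hΦ⟩ := exists_applyK_grad_row_le a ha h12 h126
  obtain ⟨kΦ', ε₁, hε₁, hkΦ', hΦ'⟩ := exists_applyK_grad_row_diff_le a ha h12 h126
  obtain ⟨kN, δ₂, hδ₂, hkN, hN⟩ := exists_applyK_gradC_le a ha h12 h126
  obtain ⟨kN', hkN', hN'⟩ := exists_applyK_gradC_diff_le a ha h12 h126
  have hcP := cPPs_nonneg 4 ha; have hcs := cPs_nonneg 4 ha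
  have hcQ₀ : 0 ≤ cQ₀ := (abs_nonneg _).trans (hcQ 0)
  set ε : ℝ := min ε₀ ε₁ with hεd
  have hε : 0 < ε := lt_min hε₀ hε₁
  have hl0 : ε ≤ ε₀ := min_le_left _ _
  have hl1 : ε ≤ ε₁ := min_le_right _ _
  set C₁ : ℝ := cQ₀ * cPPs 4 a + cPs 4 a with hC₁
  have hC₁0 : 0 ≤ C₁ := by positivity
  set c₁ : ℝ := Real.exp (ε * R) * ((R : ℝ) + 1) ^ 1 with hc₁
  set c₂ : ℝ := Real.exp (ε * R) * ((R : ℝ) + 1) ^ 2 with hc₂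
  set A₂ : ℝ := 2 * (Nat.factorial 2) * (2 / ε) ^ 2 * (1 + 2 * (4 : ℕ) * 3 ^ (4 - 1) * ((Nat.factorial (4 - 1 - 2)) * (4 / ε) ^ (4 - 1 - 2) * (1 + 4 / ε))) with hA₂
  set B₂ : ℝ := 2 * (Nat.factorial 0) * (2 / ε) ^ 0 * (1 + 2 * (4 : ℕ) * 3 ^ (4 - 1) * ((Nat.factorial (4 - 1 - 2)) * (4 / ε) ^ (4 - 1 - 2) * (1 + 4 / ε))) with hB₂
  set A₁ : ℝ := 2 * (Nat.factorial 2) * (2 / ε) ^ 2 * (1 + 2 * (4 : ℕ) * 3 ^ (4 - 1) * ((Nat.factorial (4 - 1 - 1)) * (4 / ε) ^ (4 - 1 - 1) * (1 + 4 / ε))) with hA₁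
  set B₁ : ℝ := 2 * (Nat.factorial 0) * (2 / ε) ^ 0 * (1 + 2 * (4 : ℕ) * 3 ^ (4 - 1) * ((Nat.factorial (4 - 1 - 1)) * (4 / ε) ^ (4 - 1 - 1) * (1 + 4 / ε))) with hB₁
  have hA₂0 : 0 ≤ A₂ := by positivity
  have hB₂0 : 0 ≤ B₂ := by positivity
  have hA₁0 : 0 ≤ A₁ := by positivity
  have hB₁0 : 0 ≤ B₁ := by positivity
  set G₀ : ℝ := K * C₁ * (kΦ' * c₂ * (2 * A₂ + 2 * B₂) * (kN + kN') + kΦ * c₁ * (2 * A₁ + 2 * B₁) * kN') with hG₀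
  have hG₀0 : 0 ≤ G₀ := by positivity
  refine ⟨G₀, hG₀0, fun n _ => ?_⟩
  have hn : (0 : ℝ) < n := by exact_mod_cast Nat.pos_of_ne_zero (NeZero.ne n)
  have hn1 : (1 : ℝ) ≤ n := by exact_mod_cast NeZero.one_le
  have hA : Spr (Ga n a) := spr_Ga_of_prop12 (a := a) (ha := ha) h12 h126 n
  have hC₀ : |cQ n| * cPPs 4 a + cPs 4 a ≤ C₁ := by rw [hC₁]; exact add_le_add (mul_le_mul_of_nonneg_right (hcQ n) hcP) le_rfl
  have hexpl : ∀ {ε' : ℝ} (_ : ε ≤ ε') (t : ℝ), 0 ≤ t → Real.exp (-(ε' / n) * t) ≤ Real.exp (-(ε / n) * t) := fun hle t ht =>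
    Real.exp_le_exp.2 (by rw [neg_mul, neg_mul, neg_le_neg_iff]; exact mul_le_mul_of_nonneg_right (div_le_div_of_nonneg_right hle hn.le) ht)
  have hΦn : ∀ (κ : Fin 4) (u x : Pt) (α : Fin 4), |applyK (Ga n a) (grad (ndlRow n a κ u)) x α|
      ≤ kΦ / (n : ℝ) ^ 2 * ∑ s ∈ B (n - 1) (blk (n - 1) u), |qJet n κ u (blk (n - 1) u) s|
          * (Real.exp (-(ε / n) * PoissonInterior.supNorm (d := 4) (x - s)) / nrm (x - s) ^ 1) :=
    fun κ u x α => (hΦ n κ u x α).trans (mul_le_mul_of_nonneg_left (Finset.sum_le_sum fun s _ => mul_le_mul_of_nonneg_left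
      (div_le_div_of_nonneg_right (hexpl hl0 _ (Nat.cast_nonneg _)) (pow_nonneg (nrm_pos _).le 1)) (abs_nonneg _)) (by positivity))
  have hΦ'n : ∀ (κ : Fin 4) (u x : Pt) (α i : Fin 4), |applyK (Ga n a) (grad (ndlRow n a κ u)) (x + unitVec i) α - applyK (Ga n a) (grad (ndlRow n a κ u)) x α|
      ≤ kΦ' / (n : ℝ) ^ 2 * ∑ s ∈ B (n - 1) (blk (n - 1) u), |qJet n κ u (blk (n - 1) u) s|
          * (Real.exp (-(ε / n) * PoissonInterior.supNorm (d := 4) (x - s)) / nrm (x - s) ^ 2) :=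
    fun κ u x α i => (hΦ' n κ u x α i).trans (mul_le_mul_of_nonneg_left (Finset.sum_le_sum fun s _ => mul_le_mul_of_nonneg_left
      (div_le_div_of_nonneg_right (hexpl hl1 _ (Nat.cast_nonneg _)) (pow_nonneg (nrm_pos _).le 2)) (abs_nonneg _)) (by positivity))
  have hNn : ∀ (u x : Pt) (α : Fin 4), |applyK (Ga n a) (grad (fun q => cQ n * (∑ z ∈ B (n - 1) (blk (n - 1) u), Pgt n a z q () ())
      - kerP (d := 4) (n - 1) a q (blk (n - 1) u))) x α| ≤ kN * C₁ * (n : ℝ) :=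
    fun u x α => (hN n (cQ n) u x α).trans ((mul_le_of_le_one_right (by positivity) (by
      rw [Real.exp_le_one_iff]; have : 0 ≤ δ₂ * dist (blk (n - 1) x) (blk (n - 1) u) := by positivity
      linarith)).trans (mul_le_mul_of_nonneg_right (mul_le_mul_of_nonneg_left hC₀ hkN) hn.le))
  have hN'n : ∀ (u x : Pt) (α i : Fin 4), |applyK (Ga n a) (grad (fun q => cQ n * (∑ z ∈ B (n - 1) (blk (n - 1) u), Pgt n a z q () ())
      - kerP (d := 4) (n - 1) a q (blk (n - 1) u))) (x + unitVec i) α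
      - applyK (Ga n a) (grad (fun q => cQ n * (∑ z ∈ B (n - 1) (blk (n - 1) u), Pgt n a z q () ()) - kerP (d := 4) (n - 1) a q (blk (n - 1) u))) x α|
      ≤ kN' * C₁ := fun u x α i => (hN' n (cQ n) u x α i).trans (mul_le_mul_of_nonneg_left hC₀ hkN')
  -- `((n−1)n⁻⁴)·G_n ≤ G₀` with `G_n ≤ n³·G₀`
  have hGn : K * ((kΦ' / (n : ℝ) ^ 2 * c₂ * (2 * (A₂ * (n : ℝ) ^ (4 - 2 + 2)) + 2 * (n : ℝ) ^ 2 * (B₂ * (n : ℝ) ^ (4 - 2 + 0)))) * (kN * C₁ * (n : ℝ) + kN' * C₁)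
      + (kΦ / (n : ℝ) ^ 2 * c₁ * (2 * (A₁ * (n : ℝ) ^ (4 - 1 + 2)) + 2 * (n : ℝ) ^ 2 * (B₁ * (n : ℝ) ^ (4 - 1 + 0)))) * (kN' * C₁))
      ≤ (n : ℝ) ^ 3 * G₀ := by
    rw [show (4 - 2 + 2 : ℕ) = 4 by norm_num, show (4 - 2 + 0 : ℕ) = 2 by norm_num, show (4 - 1 + 2 : ℕ) = 5 by norm_num,
      show (4 - 1 + 0 : ℕ) = 3 by norm_num]
    have e1 : K * ((kΦ' / (n : ℝ) ^ 2 * c₂ * (2 * (A₂ * (n : ℝ) ^ 4) + 2 * (n : ℝ) ^ 2 * (B₂ * (n : ℝ) ^ 2))) * (kN * C₁ * (n : ℝ) + kN' * C₁)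
        + (kΦ / (n : ℝ) ^ 2 * c₁ * (2 * (A₁ * (n : ℝ) ^ 5) + 2 * (n : ℝ) ^ 2 * (B₁ * (n : ℝ) ^ 3))) * (kN' * C₁))
        = (n : ℝ) ^ 2 * (K * C₁ * (kΦ' * c₂ * (2 * A₂ + 2 * B₂) * (kN * (n : ℝ) + kN'))) + (n : ℝ) ^ 3 * (K * C₁ * (kΦ * c₁ * (2 * A₁ + 2 * B₁) * kN')) := by
      field_simp
    rw [e1, hG₀]
    have h2 : kN * (n : ℝ) + kN' ≤ (kN + kN') * (n : ℝ) := by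
      calc kN * (n : ℝ) + kN' = kN * (n : ℝ) + kN' * 1 := by ring
        _ ≤ kN * (n : ℝ) + kN' * (n : ℝ) := add_le_add le_rfl (mul_le_mul_of_nonneg_left hn1 hkN')
        _ = (kN + kN') * (n : ℝ) := by ring
    have h3 : (n : ℝ) ^ 2 * (K * C₁ * (kΦ' * c₂ * (2 * A₂ + 2 * B₂) * (kN * (n : ℝ) + kN')))
        ≤ (n : ℝ) ^ 3 * (K * C₁ * (kΦ' * c₂ * (2 * A₂ + 2 * B₂) * (kN + kN'))) := by
      have h4 : 0 ≤ (n : ℝ) ^ 2 * (K * C₁ * (kΦ' * c₂ * (2 * A₂ + 2 * B₂))) := by positivity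
      calc (n : ℝ) ^ 2 * (K * C₁ * (kΦ' * c₂ * (2 * A₂ + 2 * B₂) * (kN * (n : ℝ) + kN')))
          = (n : ℝ) ^ 2 * (K * C₁ * (kΦ' * c₂ * (2 * A₂ + 2 * B₂))) * (kN * (n : ℝ) + kN') := by ring
        _ ≤ (n : ℝ) ^ 2 * (K * C₁ * (kΦ' * c₂ * (2 * A₂ + 2 * B₂))) * ((kN + kN') * (n : ℝ)) := mul_le_mul_of_nonneg_left h2 h4
        _ = (n : ℝ) ^ 3 * (K * C₁ * (kΦ' * c₂ * (2 * A₂ + 2 * B₂) * (kN + kN'))) := by ring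
    calc (n : ℝ) ^ 2 * (K * C₁ * (kΦ' * c₂ * (2 * A₂ + 2 * B₂) * (kN * (n : ℝ) + kN'))) + (n : ℝ) ^ 3 * (K * C₁ * (kΦ * c₁ * (2 * A₁ + 2 * B₁) * kN'))
        ≤ (n : ℝ) ^ 3 * (K * C₁ * (kΦ' * c₂ * (2 * A₂ + 2 * B₂) * (kN + kN'))) + (n : ℝ) ^ 3 * (K * C₁ * (kΦ * c₁ * (2 * A₁ + 2 * B₁) * kN')) :=
          add_le_add h3 le_rfl
      _ = _ := by ring
  have hsite : ∀ b : Pt, |fullSum (fun w : Pt => toReal w μ * toReal w ν *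
      biBubbleTable (Ga n a) (Ga n a) (ndlPiece n a (cQ n)) SbT μ ν (b + w) b)| ≤ G₀ := by
    intro b
    have h := abs_fullSum_ndlLoc_le n a ha hA hK hframe (KΦ := kΦ / (n : ℝ) ^ 2) (KΦ' := kΦ' / (n : ℝ) ^ 2) (KN := kN * C₁ * (n : ℝ)) (KN' := kN' * C₁)
      (by positivity) (by positivity) (by positivity) (by positivity) hε hΦn hΦ'n hNn hN'n μ ν b
    rw [← hc₁, ← hc₂, ← hA₂, ← hB₂, ← hA₁, ← hB₁] at h
    refine h.trans ?_
    have hmn : 0 ≤ ((n : ℝ) - 1) * ((n : ℝ) ^ 4)⁻¹ := mul_nonneg (sub_nonneg.2 hn1) (by positivity)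
    calc (((n : ℝ) - 1) * ((n : ℝ) ^ 4)⁻¹) * (K * ((kΦ' / (n : ℝ) ^ 2 * c₂ * (2 * (A₂ * (n : ℝ) ^ (4 - 2 + 2)) + 2 * (n : ℝ) ^ 2 * (B₂ * (n : ℝ) ^ (4 - 2 + 0))))
            * (kN * C₁ * (n : ℝ) + kN' * C₁)
          + (kΦ / (n : ℝ) ^ 2 * c₁ * (2 * (A₁ * (n : ℝ) ^ (4 - 1 + 2)) + 2 * (n : ℝ) ^ 2 * (B₁ * (n : ℝ) ^ (4 - 1 + 0)))) * (kN' * C₁)))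
        ≤ (((n : ℝ) - 1) * ((n : ℝ) ^ 4)⁻¹) * ((n : ℝ) ^ 3 * G₀) := mul_le_mul_of_nonneg_left hGn hmn
      _ = (((n : ℝ) - 1) / (n : ℝ)) * G₀ := by field_simp
      _ ≤ 1 * G₀ := mul_le_mul_of_nonneg_right ((div_le_one hn).2 (sub_le_self _ zero_le_one)) hG₀0
      _ = G₀ := one_mul _
  -- the base average is convex
  rw [cellSum_def]
  refine (Finset.abs_sum_le_sum_abs _ _).trans ?_
  calc ∑ b ∈ (univ : Finset (Fin 4 → Fin n)).image resSite, |((n : ℝ) ^ 4)⁻¹ *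
        fullSum (fun w : Pt => toReal w μ * toReal w ν * biBubbleTable (Ga n a) (Ga n a) (ndlPiece n a (cQ n)) SbT μ ν (b + w) b)|
      ≤ ∑ _b ∈ (univ : Finset (Fin 4 → Fin n)).image resSite, ((n : ℝ) ^ 4)⁻¹ * G₀ := by
        refine Finset.sum_le_sum fun b _ => ?_
        rw [abs_mul, abs_of_nonneg (by positivity : (0 : ℝ) ≤ ((n : ℝ) ^ 4)⁻¹)]
        exact mul_le_mul_of_nonneg_left (hsite b) (by positivity)
    _ ≤ G₀ := sum_resSite_avg_le hG₀0

end Summit.QuantumFields.BalabanUV.Beta.D1BFx.GluonNdlLocalRow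

end
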